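import Literature.Analysis.FluidPDE.GKPRigidityBackwardUniqueness
import Literature.Analysis.FluidPDE.KNSSSmoothingHolds
import HarnessLib

/-!
# GKP Proposition 2.3 for bounded Besov mild solutions, modulo the far-field regularity at the
# blow-up time: backward uniqueness down to `t = 0` and the endgame

Analysis/FluidPDE proof file (theorems only: no definition, no named fact, no `sorry`) in the
cone of `Literature.Analysis.FluidPDE.hasSmoothExtensionPast_of_eHomBesovNorm_bounded`
(Gallagher–Koch–Planchon 2016, Thm. 1) along GKP's own proof line, continuing
`GKPRigidityProofs.lean` (Steps C and E of the printed proof of **Prop. 2.3**, §2.5, and its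
endgame) and `GKPRigidityBackwardUniqueness.lean` (Step D: `u(·, t) ≡ 0` for every `t` of the
window `(T₄, T*)` on which the far-field regularity holds).

The printed proof ends: "… allow us to conclude that in fact `u(·, t) ≡ 0` for some
`t ∈ (0, T*)` … Therefore `T* = ∞` by small data results, contrary to assumption"
(arXiv:1407.4156, §2.5, p. 9): `NS(u₀)` restarted from the zero slice is the zero solution by
the uniqueness (1.6) in the path space, so `u ≡ 0` after that time and extends. The tree's
endgame (`IsBesovMildSolutionOn.not_isMaximalBesovMildSolution_of_forall_Ioo_ae_eq_zero`,
`GKPRigidityProofs.lean`) is phrased for solutions vanishing at **every** positive time; this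
file bridges the two **by backward uniqueness once more, now in the whole space and at interior
times** — where the tree already has everything: a bounded Besov mild solution is classical at
positive times with all spatial derivatives bounded on `(a, T₁) × ℝ³`, `0 < a` (KNSS 2009,
Prop. 4.1, the discharged `knss2009_smoothing_holds` through the Oseen representation
`oseenMild_of_bounded_isBesovMildSolutionOn_holds` and its restart `oseenMild_restart_holds`),
so the general-frame backward-uniqueness theorem `farField_curl_eq_zero_of_frame` with `R = 0`
and the unique continuation of the vorticity propagate `u(·, t₁) ≡ 0` to every earlier positive
time. (This replaces the appeal to "small data results" — the forward uniqueness of `NS(u₀)` in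
`𝓛^{1:∞}_p`, not in the tree for the class at hand — by Escauriaza–Seregin–Šverák's backward
uniqueness, which is; the statement reached is the printed conclusion `T*(u₀) = ∞` in the
tree's rendering "not maximal".)

Main results (`ℝ³`, `ν > 0`):

* `IsClassicalNSSolutionOn.tendsto_integral_inner_of_eq_zero` — for a classical solution on
  `(0, T)` with `u(t₁) = 0`, `∫ ⟪u(t), φ⟫ → 0` as `t ↑ t₁` (dominated convergence on the
  support of `φ`).
* `IsClassicalNSSolutionOn.curl_eq_zero_of_deriv_bounds_of_eq_zero` — **backward uniqueness
  in the whole space for classical solutions**: if `‖D_xⁿu‖ ≤ K` (`n ≤ 3`) on `(a, t₁) × ℝ³`,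
  `0 < a < t₁ < T`, and `u(t₁) = 0`, then `∇ ∧ u ≡ 0` on `(a, t₁) × ℝ³`
  (`IsClassicalNSSolutionOn.curl_eq_zero_of_farField_of_tendsto` with `R = 0`); with bounded
  realised Besov slices, `u ≡ 0` there (`…eq_zero_of_deriv_bounds_of_eq_zero`).
* `IsBesovMildSolutionOn.exists_norm_iteratedFDeriv_le_of_bounded` — **KNSS Prop. 4.1 for the
  classical representative**: for a Besov mild solution of the class `(s_p, p, q)`,
  `3 < p < ∞`, `1 ≤ q < ∞`, with slices uniformly bounded on every `(0, T₁)`, and a field `v`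
  with continuous slices, `v(t) = u(t)` a.e. (`0 < t < T`), every `D_xᵏ v` is bounded on
  `(a, T₁) × ℝ³`, `0 < a < T₁ < T`.
* `IsBesovMildSolutionOn.forall_eq_zero_of_bounded_of_farField_of_tendsto` — **Prop. 2.3 for
  the bounded class, modulo the far-field input**: such a solution, classical on `(0, T)` through
  a representative `(v, π)`, with `U t → 0` in `𝓢'` as `t → T⁻` and `‖D_xⁿv‖ ≤ K` (`n ≤ 3`) on a
  far-field region `(T₄, T) × {|x| > R}`, has `v(t) ≡ 0` for **every** `t ∈ (0, T)`; hence
  (`…not_isMaximalBesovMildSolution_of_bounded_of_farField_of_tendsto`) it is not maximal in the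
  tree's class: "`T*(u₀) = ∞`".

## References

* I. Gallagher, G. S. Koch, F. Planchon, CMP 343 (2016) = arXiv:1407.4156: Prop. 2.3 and §2.5
  (p. 9), (1.6). [GKP2016]
* L. Escauriaza, G. Seregin, V. Šverák, Russ. Math. Surveys 58:2 (2003) 211–250: Thm. 4.1,
  Thm. 5.1, §5. [EscauriazaSereginSverak2003]
* G. Koch, N. Nadirashvili, G. Seregin, V. Šverák, Acta Math. 203 (2009) 83–105 =
  arXiv:0709.3599: Prop. 4.1, Lemma 3.1. [KochNadirashviliSereginSverak2009]
-/

noncomputable section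

open MeasureTheory TopologicalSpace Set Function Filter Metric
open _root_.Topology
open scoped ENNReal NNReal InnerProductSpace RealInnerProductSpace SchwartzMap

namespace Literature.Analysis.FluidPDE

/-! ### Backward uniqueness in the whole space for classical solutions -/

/-- For a classical solution on the open strip `(0, T)` vanishing at a time `t₁ ∈ (0, T)`, the
pairings `∫ ⟪u(t), φ⟫` with smooth compactly supported fields tend to `0` as `t ↑ t₁` (indeed as
`t → t₁`: dominated convergence on a compact neighbourhood of `{t₁} × tsupport φ`, on which the
jointly continuous `u` is bounded). [folklore] -/
theorem IsClassicalNSSolutionOn.tendsto_integral_inner_of_eq_zero {ν T t₁ : ℝ}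
    {u : ℝ → EuclideanSpace ℝ (Fin 3) → EuclideanSpace ℝ (Fin 3)}
    {π : ℝ → EuclideanSpace ℝ (Fin 3) → ℝ} (hcl : IsClassicalNSSolutionOn (Ioo 0 T) ν 0 u π)
    (ht₁ : t₁ ∈ Ioo 0 T) (hzero : u t₁ = 0)
    {φ : EuclideanSpace ℝ (Fin 3) → EuclideanSpace ℝ (Fin 3)}
    (hφ : FunctionSpaces.IsTestFunctionOn (⊤ : Opens (EuclideanSpace ℝ (Fin 3))) φ) :
    Tendsto (fun t => ∫ x, ⟪u t x, φ x⟫) (𝓝[<] t₁) (𝓝 0) := by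
  -- a bounded open set containing the support, and a compact time–space box
  obtain ⟨ρ, hρ⟩ := hφ.hasCompactSupport.isCompact.isBounded.subset_ball (0 : EuclideanSpace ℝ (Fin 3))
  set a : ℝ := t₁ / 2 with hadef
  set b : ℝ := (t₁ + T) / 2 with hbdef
  have ha : 0 < a := by rw [hadef]; linarith [ht₁.1]
  have hat₁ : a < t₁ := by rw [hadef]; linarith [ht₁.1]
  have ht₁b : t₁ < b := by rw [hbdef]; linarith [ht₁.2]
  have hbT : b < T := by rw [hbdef]; linarith [ht₁.2]
  have hIsub : Icc a b ⊆ Ioo 0 T := fun t ht => ⟨ha.trans_le ht.1, ht.2.trans_lt hbT⟩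
  have hcont : ContinuousOn (uncurry u) (Ioo 0 T ×ˢ univ) := hcl.smooth_velocity.continuousOn
  have hK : IsCompact (Icc a b ×ˢ closedBall (0 : EuclideanSpace ℝ (Fin 3)) ρ) :=
    isCompact_Icc.prod (isCompact_closedBall _ _)
  obtain ⟨M₀, hM₀⟩ := hK.exists_bound_of_continuousOn
    (hcont.mono (prod_mono hIsub (subset_univ _)))
  have hM : ∀ t ∈ Ioo a b, ∀ x ∈ ball (0 : EuclideanSpace ℝ (Fin 3)) ρ, ‖u t x‖ ≤ M₀ :=
    fun t ht x hx => hM₀ (t, x) ⟨Ioo_subset_Icc_self ht, ball_subset_closedBall hx⟩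
  have hca : ContinuousAt (fun t => ∫ x, ⟪u t x, φ x⟫) t₁ :=
    continuousAt_integral_inner_of_continuousOn isOpen_Ioo isOpen_ball
      (hcont.mono (prod_mono (fun t ht => ⟨ha.trans ht.1, ht.2.trans hbT⟩) (subset_univ _)))
      hM hφ hρ ⟨hat₁, ht₁b⟩
  have h0 : ∫ x, ⟪u t₁ x, φ x⟫ = 0 := by simp [hzero]
  have h := hca.tendsto
  rw [h0] at h
  exact h.mono_left nhdsWithin_le_nhds

/-- **Backward uniqueness in the whole space for classical solutions** (Escauriaza–Seregin–
Šverák 2003, Thm. 5.1 in every half-space, i.e. beyond every `|x| > γ`, with the unique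
continuation Thm. 4.1 inwards; the mechanism of GKP 2016, §2.5). Let `(u, π)` be a classical
solution of the unforced Navier–Stokes equations (`ν > 0`) on the open strip `(0, T)` whose
spatial derivatives of order `≤ 3` are bounded on `(a, t₁) × ℝ³`, `0 < a < t₁ < T`, and which
vanishes at time `t₁`. Then `∇ ∧ u ≡ 0` on `(a, t₁) × ℝ³`: the case `R = 0` of
`IsClassicalNSSolutionOn.curl_eq_zero_of_farField_of_tendsto` for the restriction of the
solution to `(0, t₁)`, the weak vanishing at `t₁` being
`IsClassicalNSSolutionOn.tendsto_integral_inner_of_eq_zero`.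
[cite: EscauriazaSereginSverak2003, Thm. 4.1 and Thm. 5.1] [cite: GKP2016, §2.5 (proof of Prop. 2.3)] -/
theorem IsClassicalNSSolutionOn.curl_eq_zero_of_deriv_bounds_of_eq_zero {ν T a t₁ K : ℝ}
    (hν : 0 < ν) {u : ℝ → EuclideanSpace ℝ (Fin 3) → EuclideanSpace ℝ (Fin 3)}
    {π : ℝ → EuclideanSpace ℝ (Fin 3) → ℝ} (hcl : IsClassicalNSSolutionOn (Ioo 0 T) ν 0 u π)
    (ha : 0 < a) (hat₁ : a < t₁) (ht₁T : t₁ < T)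
    (hK : ∀ n ≤ 3, ∀ t ∈ Ioo a t₁, ∀ x, ‖iteratedFDeriv ℝ n (u t) x‖ ≤ K) (hzero : u t₁ = 0) :
    ∀ t ∈ Ioo a t₁, ∀ x : EuclideanSpace ℝ (Fin 3), curl (u t) x = 0 := by
  have hcl₁ : IsClassicalNSSolutionOn (Ioo 0 t₁) ν 0 u π :=
    hcl.mono (Ioo_subset_Ioo_right ht₁T.le) (uniqueDiffOn_Ioo 0 t₁)
  have hbd : ∀ n ≤ 3, ∀ w ∈ Ioo a t₁ ×ˢ (closedBall (0 : EuclideanSpace ℝ (Fin 3)) 0)ᶜ,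
      ‖iteratedFDeriv ℝ n (u w.1) w.2‖ ≤ K := fun n hn w hw => hK n hn w.1 hw.1 w.2
  have hfinal : ∀ φ : EuclideanSpace ℝ (Fin 3) → EuclideanSpace ℝ (Fin 3),
      FunctionSpaces.IsTestFunctionOn (⊤ : Opens (EuclideanSpace ℝ (Fin 3))) φ →
        Tendsto (fun t => ∫ x, ⟪u t x, φ x⟫) (𝓝[<] t₁) (𝓝 0) := fun φ hφ =>
    hcl.tendsto_integral_inner_of_eq_zero ⟨ha.trans hat₁, ht₁T⟩ hzero hφ
  exact hcl₁.curl_eq_zero_of_farField_of_tendsto hν ha hat₁ le_rfl hbd hfinal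

/-- **Backward uniqueness in the whole space, with the Liouville step**: in the situation of
`IsClassicalNSSolutionOn.curl_eq_zero_of_deriv_bounds_of_eq_zero`, if the slices `u t`,
`t ∈ (a, t₁)`, are realised homogeneous Besov distributions (`V t ∈ Ḃ^s_{p,q}` the tempered
distribution of `u t`), then `u(t, ·) ≡ 0` for every `t ∈ (a, t₁)` (the slices are bounded by
the hypothesis with `n = 0`; Step E, KNSS 2009 Lemma 3.1 and the realisation clause).
[cite: GKP2016, §2.5 (proof of Prop. 2.3)] [cite: KochNadirashviliSereginSverak2009, Lemma 3.1] -/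
theorem IsClassicalNSSolutionOn.eq_zero_of_deriv_bounds_of_eq_zero {ν T a t₁ K : ℝ}
    (hν : 0 < ν) {u : ℝ → EuclideanSpace ℝ (Fin 3) → EuclideanSpace ℝ (Fin 3)}
    {π : ℝ → EuclideanSpace ℝ (Fin 3) → ℝ} (hcl : IsClassicalNSSolutionOn (Ioo 0 T) ν 0 u π)
    (ha : 0 < a) (hat₁ : a < t₁) (ht₁T : t₁ < T)
    (hK : ∀ n ≤ 3, ∀ t ∈ Ioo a t₁, ∀ x, ‖iteratedFDeriv ℝ n (u t) x‖ ≤ K) (hzero : u t₁ = 0)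
    {s : ℝ} {p q : ℝ≥0∞} [Fact (1 ≤ p)]
    {V : ℝ → 𝓢'(EuclideanSpace ℝ (Fin 3), EuclideanSpace ℂ (Fin 3))}
    (hV : ∀ t ∈ Ioo a t₁, IsDistributionOf (u t) (V t))
    (hB : ∀ t ∈ Ioo a t₁, FunctionSpaces.MemHomBesov s p q (V t)) :
    ∀ t ∈ Ioo a t₁, u t = 0 := by
  have hcurl := hcl.curl_eq_zero_of_deriv_bounds_of_eq_zero hν ha hat₁ ht₁T hK hzero
  intro t ht
  have ht0 : t ∈ Ioo 0 T := ⟨ha.trans ht.1, ht.2.trans ht₁T⟩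
  have hM : ∀ x, ‖u t x‖ ≤ K := fun x => by
    have h := hK 0 (by norm_num) t ht x
    rwa [norm_iteratedFDeriv_zero] at h
  exact eq_zero_of_curl_eq_zero_of_isDivFree_of_memHomBesov
    ((hcl.contDiff_velocity ht0).of_le (by norm_cast)) (hcurl t ht) (hcl.divFree t ht0) hM
    (hV t ht) (hB t ht)

/-! ### KNSS Prop. 4.1 for the continuous representative of a bounded Besov mild solution -/

/-- **All spatial derivatives of a bounded Besov mild solution are bounded away from `t = 0`**
(Koch–Nadirashvili–Seregin–Šverák 2009, Prop. 4.1: "the functions `t^{k/2+l} ∇ᵏₓ ∂ₜˡ u` are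
bounded", through the tree's discharged Oseen architecture: (A)
`oseenMild_of_bounded_isBesovMildSolutionOn_holds`, (R) `oseenMild_restart_holds`, (P)
`knss2009_smoothing_holds`). Let `(u, U)` be a Besov mild solution of the class `(s_p, p, q)` on
`[0, T)`, `3 < p < ∞`, `1 ≤ q < ∞`, `ν > 0`, whose slices are uniformly essentially bounded on
every `(0, T₁)`, `T₁ < T`, and let `v` have continuous slices with `u(t) = v(t)` a.e. for
`0 < t < T` (e.g. the classical representative of `knss_classical_of_bounded_isBesovMildSolutionOn`).
Then for `0 < a < T₁ < T` and every `k` there is `C` with `‖D_xᵏ v(t, x)‖ ≤ C` on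
`(a, T₁) × ℝ³`. Proof: restart at `s = a/2`; the canonical representative
`w(t) = e^{ν(t-s)Δ}u(s) - B^ν_s(u,u)(t)` of (P) has `(t-s)^{k/2}‖D_xᵏw(t)‖ ≤ C₀` on `(s, T₁)`
and continuous slices a.e. equal to `u(t)`, hence equal to `v(t)`; on `(a, T₁)`,
`(t-s)^{k/2} ≥ (a/2)^{k/2}`. [cite: KochNadirashviliSereginSverak2009, Prop. 4.1 (arXiv:0709.3599 p. 8)] -/
theorem IsBesovMildSolutionOn.exists_norm_iteratedFDeriv_le_of_bounded {ν T : ℝ} (hν : 0 < ν)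
    (hT : 0 < T) {p q : ℝ≥0∞} [Fact (1 ≤ p)] (hp₃ : 3 < p) (hp : p < ∞) (hq₁ : 1 ≤ q) (hq : q < ∞)
    {u : ℝ → EuclideanSpace ℝ (Fin 3) → EuclideanSpace ℝ (Fin 3)}
    {U : ℝ → 𝓢'(EuclideanSpace ℝ (Fin 3), EuclideanSpace ℂ (Fin 3))}
    (hu : IsBesovMildSolutionOn (-1 + 3 / p.toReal) p q T ν u U)
    (hbd : ∀ T₁ ∈ Ioo 0 T, ∃ C : ℝ≥0∞, C < ∞ ∧ ∀ t ∈ Ioo 0 T₁, eLpNorm (u t) ∞ volume ≤ C)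
    {v : ℝ → EuclideanSpace ℝ (Fin 3) → EuclideanSpace ℝ (Fin 3)}
    (hvc : ∀ t ∈ Ioo 0 T, Continuous (v t)) (huv : ∀ t ∈ Ioo 0 T, u t =ᵐ[volume] v t)
    {a T₁ : ℝ} (ha : 0 < a) (haT₁ : a < T₁) (hT₁ : T₁ < T) (k : ℕ) :
    ∃ C : ℝ, ∀ t ∈ Ioo a T₁, ∀ x, ‖iteratedFDeriv ℝ k (v t) x‖ ≤ C := by
  -- (A): the integral equation from the datum
  have hA' := oseenMild_of_bounded_isBesovMildSolutionOn_holds hν hT hp₃ hp hq₁ hq hu hbd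
  have hmeas : AEStronglyMeasurable (uncurry u) (volume.restrict (Ioo 0 T ×ˢ univ)) :=
    hu.aestronglyMeasurable
  have hmeas₀ : AEStronglyMeasurable (u 0) volume :=
    (hu.isDistributionOf 0 ⟨le_rfl, hT⟩).aestronglyMeasurable
  -- the datum is bounded by the same constants (Besov continuity at `t = 0`)
  have hbd₀ : ∀ T₁ ∈ Ioo 0 T, ∃ C : ℝ≥0∞, C < ∞ ∧ ∀ t ∈ Ico 0 T₁, eLpNorm (u t) ∞ volume ≤ C := by
    intro T₁ hT₁
    obtain ⟨C, hC, hCb⟩ := hbd T₁ hT₁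
    have hs := gkp_index_mem_Ioo hp₃ hp
    have h0 : eLpNorm (u 0) ∞ volume ≤ C :=
      eLpNorm_top_zero_le_of_continuousInHomBesovOn hs.2 (by linarith [hs.1]) hq₁ hT₁.1 hT₁.2.le
        hu.continuousInHomBesovOn hu.isDistributionOf hC hCb
    refine ⟨C, hC, fun t ht => ?_⟩
    rcases ht.1.eq_or_lt with h | h
    · rw [← h]; exact h0
    · exact hCb t ⟨h, ht.2⟩
  -- (R): restart at `s = a / 2`
  set s : ℝ := a / 2 with hsdef
  have hs : 0 < s := half_pos ha
  have hsa : s < a := half_lt_self ha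
  have hsT₁ : s < T₁ := hsa.trans haT₁
  have hR' : ∀ ⦃t : ℝ⦄, s < t → t < T → u t =ᵐ[volume] fun x =>
      UnboundedOperators.heatExtension (u s) (ν * (t - s)) x - oseenDuhamel ν s u u t x :=
    fun t hst htT => oseenMild_restart_holds (EuclideanSpace ℝ (Fin 3)) hν hT hmeas hmeas₀ hbd₀
      hA' hs hst htT
  -- (P) on `(s, T₁)`
  set w : ℝ → EuclideanSpace ℝ (Fin 3) → EuclideanSpace ℝ (Fin 3) := fun t x =>
    UnboundedOperators.heatExtension (u s) (ν * (t - s)) x - oseenDuhamel ν s u u t x with hw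
  obtain ⟨C, hC, hCb⟩ := hbd T₁ ⟨hs.trans hsT₁, hT₁⟩
  have hCM : C = ENNReal.ofReal C.toReal := (ENNReal.ofReal_toReal hC.ne).symm
  have hua : eLpNorm (u s) ∞ volume ≤ ENNReal.ofReal C.toReal := hCM ▸ hCb s ⟨hs, hsT₁⟩
  have hub : ∀ t ∈ Ioo s T₁, eLpNorm (u t) ∞ volume ≤ ENNReal.ofReal C.toReal :=
    fun t ht => hCM ▸ hCb t ⟨hs.trans ht.1, ht.2⟩
  have hmeas_s : AEStronglyMeasurable (uncurry u) (volume.restrict (Ioo s T₁ ×ˢ univ)) :=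
    hmeas.mono_measure
      (Measure.restrict_mono (prod_mono (Ioo_subset_Ioo hs.le hT₁.le) Subset.rfl) le_rfl)
  have hsl : AEStronglyMeasurable (u s) volume :=
    (hu.isDistributionOf s ⟨hs.le, hsT₁.trans hT₁⟩).aestronglyMeasurable
  obtain ⟨hwsmooth, -, hwbd⟩ := knss2009_smoothing_holds (EuclideanSpace ℝ (Fin 3)) hν hsT₁
    ENNReal.toReal_nonneg hsl hua hmeas_s hub (fun t ht => hR' ht.1 (ht.2.trans hT₁))
  -- `w t = v t` on `(s, T₁)`: continuous slices a.e. equal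
  have hwv : ∀ t ∈ Ioo s T₁, w t = v t := by
    intro t ht
    have htT : t ∈ Ioo 0 T := ⟨hs.trans ht.1, ht.2.trans hT₁⟩
    have hwc : Continuous (w t) := (hwsmooth.contDiff_slice ht).continuous
    exact (hwc.ae_eq_iff_eq volume (hvc t htT)).1 ((hR' ht.1 htT.2).symm.trans (huv t htT))
  -- the weighted bound with `l = 0`
  obtain ⟨C₀, hC₀⟩ := hwbd k 0
  refine ⟨C₀ / (a / 2) ^ ((k : ℝ) / 2), fun t ht x => ?_⟩
  have hts : t ∈ Ioo s T₁ := ⟨hsa.trans ht.1, ht.2⟩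
  have hkey := hC₀ t hts x
  simp only [Nat.cast_zero, add_zero, iteratedDeriv_zero] at hkey
  have hwt : (fun y => w t y) = v t := by rw [← hwv t hts]
  rw [hwt] at hkey
  have hpos : 0 < (a / 2) ^ ((k : ℝ) / 2) := Real.rpow_pos_of_pos (half_pos ha) _
  have hle : (a / 2) ^ ((k : ℝ) / 2) ≤ (t - s) ^ ((k : ℝ) / 2) :=
    Real.rpow_le_rpow (half_pos ha).le (by rw [hsdef]; linarith [ht.1]) (by positivity)
  rw [le_div_iff₀ hpos]
  calc ‖iteratedFDeriv ℝ k (v t) x‖ * (a / 2) ^ ((k : ℝ) / 2)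
      ≤ ‖iteratedFDeriv ℝ k (v t) x‖ * (t - s) ^ ((k : ℝ) / 2) :=
        mul_le_mul_of_nonneg_left hle (norm_nonneg _)
    _ = (t - s) ^ ((k : ℝ) / 2) * ‖iteratedFDeriv ℝ k (v t) x‖ := mul_comm _ _
    _ ≤ C₀ := hkey

/-! ### Prop. 2.3 for the bounded class, modulo the far-field regularity at the final time -/

/-- **GKP 2016, Prop. 2.3 for bounded Besov mild solutions, modulo the far-field regularity at
the blow-up time.** Let `ν > 0`, `3 < p < ∞`, `1 ≤ q < ∞`, and let `(u, U)` be a Besov mild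
solution of the class `(s_p, p, q)` on `[0, T)` whose slices are uniformly essentially bounded
on every `(0, T₁)`, `T₁ < T`, with a classical representative `(v, π)` on the open strip
`(0, T)` (`u(t) = v(t)` a.e.; (1.6), here the discharged
`knss_classical_of_bounded_isBesovMildSolutionOn`). Assume the hypothesis of Prop. 2.3,
`U t → 0` in `𝓢'(ℝ³, ℂ³)` as `t → T⁻`, and the output of Prop. 2.8 with ε-regularity in §2.5:
`‖D_xⁿv‖ ≤ K` (`n ≤ 3`) on a far-field region `(T₄, T) × {|x| > R}`, `0 < T₄ < T`, `R ≥ 0`.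
Then `v(t, ·) ≡ 0` for **every** `t ∈ (0, T)`. Proof: on `(T₄, T)` by Steps C–E
(`IsBesovMildSolutionOn.eq_zero_of_classical_of_farField_of_tendsto`, applied to the Besov mild
solution `(v, U)`-slices: `U t` is also the distribution of `v t`); at an earlier time `t`, by
backward uniqueness in the whole space on `(t/2, t₁)`, `t₁ = (T₄ + T)/2`
(`IsClassicalNSSolutionOn.eq_zero_of_deriv_bounds_of_eq_zero`), the derivative bounds being
KNSS Prop. 4.1 (`IsBesovMildSolutionOn.exists_norm_iteratedFDeriv_le_of_bounded`).
[cite: GKP2016, Prop. 2.3 and §2.5] [cite: EscauriazaSereginSverak2003, Thm. 4.1 and Thm. 5.1] -/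
theorem IsBesovMildSolutionOn.forall_eq_zero_of_bounded_of_farField_of_tendsto {ν T T₄ R K : ℝ}
    (hν : 0 < ν) {p q : ℝ≥0∞} [Fact (1 ≤ p)] (hp₃ : 3 < p) (hp : p < ∞) (hq₁ : 1 ≤ q)
    (hq : q < ∞) {u v : ℝ → EuclideanSpace ℝ (Fin 3) → EuclideanSpace ℝ (Fin 3)}
    {U : ℝ → 𝓢'(EuclideanSpace ℝ (Fin 3), EuclideanSpace ℂ (Fin 3))}
    {π : ℝ → EuclideanSpace ℝ (Fin 3) → ℝ}
    (hu : IsBesovMildSolutionOn (-1 + 3 / p.toReal) p q T ν u U)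
    (hbd : ∀ T₁ ∈ Ioo 0 T, ∃ C : ℝ≥0∞, C < ∞ ∧ ∀ t ∈ Ioo 0 T₁, eLpNorm (u t) ∞ volume ≤ C)
    (hcl : IsClassicalNSSolutionOn (Ioo 0 T) ν 0 v π) (huv : ∀ t ∈ Ioo 0 T, u t =ᵐ[volume] v t)
    (hT₄ : 0 < T₄) (hT₄T : T₄ < T) (hR : 0 ≤ R)
    (hfar : ∀ n ≤ 3, ∀ w ∈ Ioo T₄ T ×ˢ (closedBall (0 : EuclideanSpace ℝ (Fin 3)) R)ᶜ,
      ‖iteratedFDeriv ℝ n (v w.1) w.2‖ ≤ K)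
    (hlim : Tendsto U (𝓝[<] T) (𝓝 0)) :
    ∀ t ∈ Ioo 0 T, v t = 0 := by
  have hT : 0 < T := hT₄.trans hT₄T
  have hvc : ∀ t ∈ Ioo 0 T, Continuous (v t) := fun t ht => (hcl.contDiff_velocity ht).continuous
  -- the distributions, Besov membership and bounds of the slices of `v`
  have hVv : ∀ t ∈ Ioo 0 T, IsDistributionOf (v t) (U t) := fun t ht =>
    (hu.isDistributionOf t ⟨ht.1.le, ht.2⟩).congr_ae (huv t ht)
  have hBv : ∀ t ∈ Ioo 0 T, FunctionSpaces.MemHomBesov (-1 + 3 / p.toReal) p q (U t) :=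
    fun t ht => hu.continuousInHomBesovOn.1 t ⟨ht.1.le, ht.2⟩
  have hMv : ∀ t ∈ Ioo 0 T, ∃ M : ℝ, ∀ x, ‖v t x‖ ≤ M := by
    intro t ht
    have hfin : eLpNorm (v t) ∞ volume < ∞ := by
      rw [← eLpNorm_congr_ae (huv t ht)]
      exact hu.eLpNorm_top_lt_top ht
    exact ⟨(eLpNorm (v t) ∞ volume).toReal,
      norm_le_of_eLpNorm_top_le_of_continuous (hvc t ht) hfin.ne le_rfl⟩
  -- ## the window `(T₄, T)`: Steps C–E
  have hev : ∀ᶠ t in 𝓝[<] T, IsDistributionOf (v t) (U t) := by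
    filter_upwards [Ioo_mem_nhdsLT hT] with t ht using hVv t ht
  have hfinal : ∀ φ : EuclideanSpace ℝ (Fin 3) → EuclideanSpace ℝ (Fin 3),
      FunctionSpaces.IsTestFunctionOn (⊤ : Opens (EuclideanSpace ℝ (Fin 3))) φ →
        Tendsto (fun t => ∫ x, ⟪v t x, φ x⟫) (𝓝[<] T) (𝓝 0) := fun φ hφ =>
    tendsto_integral_inner_of_tendsto_temperedDistribution_zero hev hlim hφ.contDiff
      hφ.hasCompactSupport
  have hwin : ∀ t ∈ Ioo T₄ T, v t = 0 :=
    hcl.eq_zero_of_farField_of_tendsto hν hT₄ hT₄T hR hfar hfinal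
      (fun t ht => hMv t ⟨hT₄.trans ht.1, ht.2⟩) (V := U) (s := -1 + 3 / p.toReal) (p := p)
      (q := q) (fun t ht => hVv t ⟨hT₄.trans ht.1, ht.2⟩) (fun t ht => hBv t ⟨hT₄.trans ht.1, ht.2⟩)
  -- ## earlier times: backward uniqueness in the whole space
  intro t ht
  by_cases htw : T₄ < t
  · exact hwin t ⟨htw, ht.2⟩
  push Not at htw
  set t₁ : ℝ := (T₄ + T) / 2 with ht₁def
  have hT₄t₁ : T₄ < t₁ := by rw [ht₁def]; linarith
  have ht₁T : t₁ < T := by rw [ht₁def]; linarith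
  have hzero : v t₁ = 0 := hwin t₁ ⟨hT₄t₁, ht₁T⟩
  set a : ℝ := t / 2 with hadef
  have ha : 0 < a := half_pos ht.1
  have hat : a < t := half_lt_self ht.1
  have hat₁ : a < t₁ := hat.trans_le (htw.trans hT₄t₁.le)
  -- derivative bounds on `(a, t₁) × ℝ³`
  have hKn : ∀ n : ℕ, ∃ C : ℝ, ∀ τ ∈ Ioo a t₁, ∀ x, ‖iteratedFDeriv ℝ n (v τ) x‖ ≤ C := fun n =>
    hu.exists_norm_iteratedFDeriv_le_of_bounded hν hT hp₃ hp hq₁ hq hbd hvc huv ha hat₁ ht₁T n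
  obtain ⟨C₀, hC₀⟩ := hKn 0
  obtain ⟨C₁, hC₁⟩ := hKn 1
  obtain ⟨C₂, hC₂⟩ := hKn 2
  obtain ⟨C₃, hC₃⟩ := hKn 3
  set K' : ℝ := max (max C₀ C₁) (max C₂ C₃) with hK'def
  have hK' : ∀ n ≤ 3, ∀ τ ∈ Ioo a t₁, ∀ x, ‖iteratedFDeriv ℝ n (v τ) x‖ ≤ K' := by
    intro n hn τ hτ x
    interval_cases n
    · exact (hC₀ τ hτ x).trans ((le_max_left _ _).trans (le_max_left _ _))
    · exact (hC₁ τ hτ x).trans ((le_max_right _ _).trans (le_max_left _ _))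
    · exact (hC₂ τ hτ x).trans ((le_max_left _ _).trans (le_max_right _ _))
    · exact (hC₃ τ hτ x).trans ((le_max_right _ _).trans (le_max_right _ _))
  exact hcl.eq_zero_of_deriv_bounds_of_eq_zero hν ha hat₁ ht₁T hK' hzero (V := U)
    (s := -1 + 3 / p.toReal) (p := p) (q := q)
    (fun τ hτ => hVv τ ⟨ha.trans hτ.1, hτ.2.trans ht₁T⟩)
    (fun τ hτ => hBv τ ⟨ha.trans hτ.1, hτ.2.trans ht₁T⟩) t ⟨hat, htw.trans_lt hT₄t₁⟩

/-- **"Therefore `T*(u₀) = +∞`" — GKP 2016, Prop. 2.3 for the bounded class, modulo the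
far-field regularity, in the tree's rendering.** In the situation of
`IsBesovMildSolutionOn.forall_eq_zero_of_bounded_of_farField_of_tendsto`, `(u, U)` is not a
maximal Besov mild solution with lifespan `T`: `u(t) = 0` a.e. for every `t ∈ (0, T)`, and the
endgame of `GKPRigidityProofs.lean`
(`IsBesovMildSolutionOn.not_isMaximalBesovMildSolution_of_forall_Ioo_ae_eq_zero`: the zero
pair extends it) applies, the class `(s_p, p, q)` having `-1 < s_p < 0`, `1 ≤ q`.
[cite: GKP2016, Prop. 2.3 and §2.5] -/
theorem IsBesovMildSolutionOn.not_isMaximalBesovMildSolution_of_bounded_of_farField_of_tendsto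
    {ν T T₄ R K : ℝ} (hν : 0 < ν) {p q : ℝ≥0∞} [Fact (1 ≤ p)] (hp₃ : 3 < p) (hp : p < ∞)
    (hq₁ : 1 ≤ q) (hq : q < ∞) {u v : ℝ → EuclideanSpace ℝ (Fin 3) → EuclideanSpace ℝ (Fin 3)}
    {U : ℝ → 𝓢'(EuclideanSpace ℝ (Fin 3), EuclideanSpace ℂ (Fin 3))}
    {π : ℝ → EuclideanSpace ℝ (Fin 3) → ℝ}
    (hu : IsBesovMildSolutionOn (-1 + 3 / p.toReal) p q T ν u U)
    (hbd : ∀ T₁ ∈ Ioo 0 T, ∃ C : ℝ≥0∞, C < ∞ ∧ ∀ t ∈ Ioo 0 T₁, eLpNorm (u t) ∞ volume ≤ C)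
    (hcl : IsClassicalNSSolutionOn (Ioo 0 T) ν 0 v π) (huv : ∀ t ∈ Ioo 0 T, u t =ᵐ[volume] v t)
    (hT₄ : 0 < T₄) (hT₄T : T₄ < T) (hR : 0 ≤ R)
    (hfar : ∀ n ≤ 3, ∀ w ∈ Ioo T₄ T ×ˢ (closedBall (0 : EuclideanSpace ℝ (Fin 3)) R)ᶜ,
      ‖iteratedFDeriv ℝ n (v w.1) w.2‖ ≤ K)
    (hlim : Tendsto U (𝓝[<] T) (𝓝 0)) :
    ¬ IsMaximalBesovMildSolution (-1 + 3 / p.toReal) p q T ν u U := by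
  have hv0 := hu.forall_eq_zero_of_bounded_of_farField_of_tendsto hν hp₃ hp hq₁ hq hbd hcl huv
    hT₄ hT₄T hR hfar hlim
  have hs := gkp_index_mem_Ioo hp₃ hp
  refine hu.not_isMaximalBesovMildSolution_of_forall_Ioo_ae_eq_zero hs.2 (by linarith [hs.1]) hq₁
    (hT₄.trans hT₄T) fun t ht => ?_
  have h := huv t ht
  rw [hv0 t ht] at h
  exact h

end Literature.Analysis.FluidPDE

end
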